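import Summits.QuantumFields.YangMills.Theorems.BalabanUVNodesN12FlatDatumRigidityPrelim
import HarnessLib

/-!
# BalabanUVNodes ∕ N12 — RIGIDITY AT THE FLAT DATUM (the GAUGE HALF of [15] Thm 1's uniqueness at `V ≡ 1` for the record's determining set `𝐁_k(Z) = Bj M₁ Z k`):
# a holonomy-flat configuration with trivial straight transporters on the constrained bonds is `1^{u}` with `u = 1` AT EVERY TOWER SITE

[Balaban1985Variational] = «[15]», Thm 1 p. 279 («a unique critical orbit in the space (6)»), (3)–(4) p. 278 (the group (4): `u(y) = 1` for `y ∈ 𝔅_k`); [Balaban1988Convergent] =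
«[III]», (2.2) p. 255, (2.10)–(2.13) pp. 256–257; [Balaban1987RG1] (0.1)–(0.4), (0.11) pp. 251–253; [Balaban1985Averaging] (8), (11) pp. 18–19; [Balaban1984PropagatorsI] (1.7) p. 18;
I. Montvay, G. Münster, *Quantum fields on a lattice* (1994) (3.124)–(3.125) [MontvayMunster1994].

Cell `pub-ymgap` (HUMAN RULINGS D-0062 ∕ D-0149), WIDTH SEAT `pub-ymgap-dag-n12-w6` g17 (node N12 = [B15]; key K1⁹ `stmt-QuantumFields-27364`, `--kind proof --supports … --as helper`;
count-neutral; lane word n12-c g26 «GO, WANTED» I.28810).  THEOREMS ONLY (0 `def`, 0 `instance`, 0 `sorry`).  Consumed BY NAME: PART 1 `…N12FlatDatumRigidityPrelim` (combs, segments, the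
local chain words), this seat's `…N12TowerSiteGraphConnectedBjPrelim` (`exists_level`, `level_unique`), `T4Continuum.holAt_gaugeAct_walk` ([Balaban1985Averaging] (8) telescoped),
`B16Sect1Backgrounds` (`toMS`, `mulG`, `gaugeAct_gaugeAct`).

THE THEOREM (★★★ `exists_gauge_eq_one_on_towers_of_flat_segments`; generic `P : Params`, generic `GaugeGroup G`, ANY `Z ⊂ T_η`, `1 ≤ k ≤ m + K`, `2 ≤ M₁`, `LᵏM₁ ∣ 2L^{m+K}`, and the
LETTER BUDGET `(d+3)Lᵏ ≤ 2L^{m+K}` — at the record `d = 4`, `L ≥ 13`, `k + 1 ≤ m + K` give it).  Let `U` be HOLONOMY-FLAT (trivial holonomy along every word of zero net displacement;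
on `SU(N)` = trivial plaquettes, UST `Prop7FlatDatum.holFlat_of_plaqHol_eq_one`) with TRIVIAL STRAIGHT TRANSPORTERS on the constrained bonds (`U(ι_j c₋ → Lʲ e_c) = 1`, `c ∈ bondsOf
(𝐁_k(Z) j)`, `j ≤ k`; = the (2.12) constraint `M˙(U) = M˙(1)` for flat `U`, UST `iter_blockAvg_eq_straightIter_of_flat`).  THEN `U = 1^{u}` for a gauge transformation `u` with
`u(ι_j c₋) = u(ι_j c₊) = 1` for every constrained bond `c` — print's group (4).  COROLLARY (★★★ `exists_towerCentral_gauge_of_flat_segments`): two such configurations `U, U₀` are related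
by `U^u = U₀` with `u` EQUAL AND CENTRAL (indeed `= 1`) at the two tower sites of every constrained bond — the (T1@q₀)-central clause of the (J0′) producer of record (dag-n12-c V4 p722394
:173–:176 ∕ U2 p724662 ∕ U3 p725063) between flat fibre configurations, i.e. its A2 inhabitant at the flat base field once the N12 reading supplies holonomy-flatness from `A(U) ≤ A(1) = 0`
(PART 3, `…N12Thm1RowAtFlatDatum`).

THE PROOF (no global winding analysis).  Choose a level `ℓ(x)` for every fine site (w3's (Cov)); `τ x := ι_ℓ B^ℓ(x)` is a tower site and `u(x) := U(comb τx → x)⁻¹` (the comb of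
[Balaban1984PropagatorsI] (1.7) inside the `ℓ`-block).  For a fine bond `b = ⟨x, x + e_μ⟩` the CLOSED word «comb(x) · b · comb(x+e_μ)⁻¹ · (PART 1's chain of constrained segments
τ(x+e_μ) → τx)⁻¹» at `τ x` has at most `(Lᵏ−1) + 1 + (Lᵏ−1) + (d+1)Lᵏ < (d+3)Lᵏ ≤ 2L^{m+K}` net letters per direction, hence ZERO net displacement (`netDisp_eq_zero_of_walkEnd_eq`), so
holonomy-flatness gives `U(comb x)·U(b)·U(comb (x+e_μ))⁻¹ = 1`, i.e. `U = 1^{u}`.  At a `Γ_j`-site `s` the level of `ι_j s` is `j` (`level_unique`) and the comb is empty, so `u = 1` there;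
at the other end of a constrained bond `u` agrees by the trivial straight transporter and (8) telescoped (`holAt_gaugeAct_walk`).

HONEST FRAMING.  A rigidity theorem for FLAT fibre configurations (lattice combinatorics + the word calculus, by name over landed kernel theorems); it inhabits ONE displayed row of the
(J0′) producer at ONE base field (non-vacuity), nothing of Bałaban's estimates; count-neutral helper; N12 NOT discharged; K1⁹ NOT closed; counts of record unmoved; one finite 𝕋⁴
programme at fixed ε — R4 closes the conditional rung `BalabanLadder.UV` only; the Yang–Mills mass gap (Clay) is NOT proved by any of this; nothing continuum ∕ ℝ⁴ ∕ OS.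
-/

namespace Summit.QuantumFields.YangMills.BalabanUVNodes.N12FlatDatumRigidity

open Set
open Literature.MathematicalPhysics.QuantumFieldTheory.Balaban1983to89
open B15DeterminingSets (DetSet pts mem_pts bondsOf embIter)
open B14.Eq213DetSet (Bj maxDomT)
open B14.Eq213MaximalDomains (side)
open B14.Eq22Determines (blockIter blockIter_zero blockIter_succ)
open B15Eq112TorusCover (cover lift cover_lift)
open T4Continuum (walk walkEnd holAt netDisp Letter LStep wordRev walk_append walkEnd_append holAt_append holAt_walk_wordRev wordRev_replicate
  netDisp_wordRev holAt_nil holAt_cons netDisp_cons walkEnd_apply walkEnd_walkEnd_wordRev holAt_gaugeAct_walk)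
open T4ReflectionCone (netDisp_append netDisp_replicate)
open B7Prop1Explicit (treeWord treeWord_zero)
open B16Sect1Backgrounds (toMS mulG gaugeAct_gaugeAct)
open Summit.QuantumFields.YangMills.Theorems.Prop7FlatHolonomy (holAt_walk_append holAt_walk_single_true)
open Summit.QuantumFields.YangMills.BalabanUVNodes.N12BlockChains (embIter_shift_eq_walkEnd)
open Summit.QuantumFields.YangMills.Theorems.N21ReadSetSupport (blockIter_embIter)
open Summit.QuantumFields.YangMills.BalabanUVNodes.N12TowerSiteGraphConnectedBjPrelim (one_le_of_two_le exists_level level_unique)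
open Summit.QuantumFields.YangMills.BalabanUVNodes.N12FlatDatumRigidityPrelim

variable {P : Params} {G : Type*} [GaugeGroup G] {M₁ k : ℕ} {Z : Set (Site P 0)}

/-! ## §1  Two bookkeeping facts: the trivial configuration has trivial holonomies; the comb at its own base is empty -/

/-- The trivial configuration has trivial holonomy along every step sequence (private: the same bookkeeping fact is landed in the Spine as `…Spine.NE7.holAt_one`, not importable into
`Theorems`). [cite: Balaban1985Averaging, (9) p.19 (bookkeeping)] -/
private theorem holAt_one_eq_one {j : ℕ} : ∀ γ : List (LStep P j), holAt (1 : GaugeField P j G) γ = 1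
  | [] => holAt_nil _
  | s :: γ => by
    rw [holAt_cons, holAt_one_eq_one γ, mul_one]
    show (if s.fwd then (1 : G) else (1 : G)⁻¹) = 1
    split <;> simp

/-- `(8)` TELESCOPED FOR A PURE GAUGE: `𝒰(walk)(1^{u}) = u(start)·u(end)⁻¹` (`T4Continuum.holAt_gaugeAct_walk` at `U = 1`). [cite: Balaban1985Averaging, (8) p.18] -/
theorem holAt_gaugeAct_one_walk {j : ℕ} (u : GaugeTransf P j G) (x : Site P j) (w : List (Letter P.d)) :
    holAt (GaugeField.gaugeAct u 1) (walk x w) = u x * (u (walkEnd x w))⁻¹ := by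
  rw [holAt_gaugeAct_walk, holAt_one_eq_one, mul_one]

/-- The comb from a tower site to a fine site it EQUALS is empty, so its holonomy is `1`. [cite: Balaban1984PropagatorsI, (1.7) p.18 (bookkeeping)] -/
theorem holAt_comb_eq_one_of_eq (U : GaugeField P 0 G) {n : ℕ} (y : Site P n) (x : Site P 0) (h : embIter n y = x) :
    holAt U (walk (embIter n y) (treeWord (fun ν => lift P x ν - lift P (embIter n y) ν))) = 1 := by
  subst h
  rw [treeWord_liftSub_self]
  exact holAt_nil _

/-! ## §2  The rigidity theorem -/

/-- ★★★ **RIGIDITY AT THE FLAT DATUM — THE GAUGE HALF OF [15] THM 1's UNIQUENESS AT `V ≡ 1` FOR `𝐁_k(Z)`.**  For ANY `Z ⊂ T_η`, `1 ≤ k ≤ m + K`, `2 ≤ M₁`, `LᵏM₁ ∣ 2L^{m+K}` and the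
letter budget `(d+3)Lᵏ ≤ 2L^{m+K}`: a HOLONOMY-FLAT configuration `U` (trivial holonomy along every word of zero net displacement) whose straight transporters along the constrained bonds of
`𝐁_k(Z)` are trivial (`U(ι_j c₋ → Lʲ e_c) = 1` for `c ∈ bondsOf (𝐁_k(Z) j)`, `j ≤ k`) is `1^{u}` for a gauge transformation `u` with `u(ι_j c₋) = u(ι_j c₊) = 1` at the tower sites of every
constrained bond — print's group (4).  Proof: comb gauge `u(x) = U(comb τx → x)⁻¹` at the tower projection of `x`; the local closed word «comb · bond · comb⁻¹ · chain⁻¹» has zero net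
displacement by the letter budget, so holonomy-flatness gives `U = 1^{u}`; `u = 1` at the `Γ`-ends (empty comb, `level_unique`) and at the other ends by (8) telescoped along the trivial
segment. [cite: Balaban1985Variational, Thm 1 p.279, (3)–(4) p.278; Balaban1988Convergent, (2.2) p.255, (2.10)–(2.13) pp.256–257; Balaban1985Averaging, (8), (11) pp.18–19; MontvayMunster1994, (3.124)-(3.125) p.120] -/
theorem exists_gauge_eq_one_on_towers_of_flat_segments (hM : 2 ≤ M₁) (hk1 : 1 ≤ k) (hk : k ≤ P.m + P.K) (hdiv : side P.L M₁ k ∣ P.sitesPerDir 0)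
    (hfit : (P.d + 3) * P.L ^ k ≤ P.sitesPerDir 0)
    (U : GaugeField P 0 G) (hflat : ∀ (x : Site P 0) (w : List (Letter P.d)), (∀ ν, netDisp w ν = 0) → holAt U (walk x w) = 1)
    (hseg : ∀ j, j ≤ k → ∀ c ∈ bondsOf (Bj M₁ Z k j), holAt U (walk (embIter j c.src) (List.replicate (P.L ^ j) (c.dir, true))) = 1) :
    ∃ u : GaugeTransf P 0 G, (∀ j, j ≤ k → ∀ c ∈ bondsOf (Bj M₁ Z k j), u (embIter j c.src) = 1 ∧ u (embIter j c.tgt) = 1) ∧ GaugeField.gaugeAct u 1 = U := by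
  have hM1 : 1 ≤ M₁ := one_le_of_two_le hM
  -- a level for every fine site (dag-n12-w3's (Cov)); the tower projection `τ`, the comb word `cw`, the comb gauge `u`
  choose lv hlv using fun x : Site P 0 => exists_level (Z := Z) hM1 hk1 hk hdiv x
  obtain ⟨τ, hτ⟩ : ∃ τ : Site P 0 → Site P 0, ∀ x, τ x = embIter (lv x) (blockIter (lv x) x) := ⟨_, fun _ => rfl⟩
  obtain ⟨cw, hcw⟩ : ∃ cw : Site P 0 → List (Letter P.d), ∀ x, cw x = treeWord (fun ν => lift P x ν - lift P (τ x) ν) := ⟨_, fun _ => rfl⟩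
  have hcw_end : ∀ x, walkEnd (τ x) (cw x) = x := fun x => by rw [hcw]; exact walkEnd_treeWord_liftSub (τ x) x
  have hcw_nd : ∀ x ν, (netDisp (cw x) ν).natAbs ≤ P.L ^ k - 1 := fun x ν => by
    rw [hcw, hτ]
    have h := natAbs_netDisp_treeWord_liftSub_le ((hlv x).1.trans hk) (blockIter_embIter ((hlv x).1.trans hk) (blockIter (lv x) x)) ν
    exact le_trans h (Nat.sub_le_sub_right (Nat.pow_le_pow_right P.L_pos (hlv x).1) 1)
  -- ★ THE BOND IDENTITY from the local closed word: `U(comb b₋) · U(b) · U(comb b₊)⁻¹ = 1`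
  have hbond : ∀ b : PBond P 0, holAt U (walk (τ b.src) (cw b.src)) * U b * (holAt U (walk (τ b.tgt) (cw b.tgt)))⁻¹ = 1 := by
    intro b
    obtain ⟨ω, hωend₀, hωhol₀, hωnd⟩ := exists_chainWord_of_shift hM hk1 hk hdiv hseg b.src b.dir (hlv b.src).1 (hlv b.tgt).1 (hlv b.src).2 (hlv b.tgt).2
    have hωend : walkEnd (τ b.src) ω = τ b.tgt := by rw [hτ, hτ]; exact hωend₀
    have hωhol : holAt U (walk (τ b.src) ω) = 1 := by rw [hτ]; exact hωhol₀
    -- ends of the partial words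
    have e2 : walkEnd b.tgt (wordRev (cw b.tgt)) = τ b.tgt := by
      have h := walkEnd_walkEnd_wordRev (τ b.tgt) (cw b.tgt); rwa [hcw_end] at h
    have e3 : walkEnd (τ b.tgt) (wordRev ω) = τ b.src := by
      have h := walkEnd_walkEnd_wordRev (τ b.src) ω; rwa [hωend] at h
    have end2 : walkEnd (τ b.src) (cw b.src ++ [(b.dir, true)]) = b.tgt := by rw [walkEnd_append, hcw_end]; rfl
    have end3 : walkEnd (τ b.src) (cw b.src ++ [(b.dir, true)] ++ wordRev (cw b.tgt)) = τ b.tgt := by rw [walkEnd_append, end2, e2]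
    have hclosed : walkEnd (τ b.src) (cw b.src ++ [(b.dir, true)] ++ wordRev (cw b.tgt) ++ wordRev ω) = τ b.src := by
      rw [walkEnd_append, end3, e3]
    -- the letter budget: fewer than `(d+3)Lᵏ ≤ N` net letters per direction
    have hsmall : ∀ ν, (netDisp (cw b.src ++ [(b.dir, true)] ++ wordRev (cw b.tgt) ++ wordRev ω) ν).natAbs < P.sitesPerDir 0 := by
      intro ν
      rw [netDisp_append, netDisp_append, netDisp_append, netDisp_wordRev, netDisp_wordRev]
      have h1 := hcw_nd b.src ν
      have h2 := hcw_nd b.tgt ν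
      have h3 := hωnd ν
      have h4 : (netDisp [((b.dir, true) : Letter P.d)] ν).natAbs ≤ 1 := natAbs_netDisp_le_length _ ν
      have hLk : 1 ≤ P.L ^ k := Nat.one_le_pow _ _ P.L_pos
      have e : (P.d + 3) * P.L ^ k = (P.d + 1) * P.L ^ k + 2 * P.L ^ k := by ring
      rw [e] at hfit
      have t1 := Int.natAbs_add_le (netDisp (cw b.src) ν + netDisp [((b.dir, true) : Letter P.d)] ν + -netDisp (cw b.tgt) ν) (-netDisp ω ν)
      have t2 := Int.natAbs_add_le (netDisp (cw b.src) ν + netDisp [((b.dir, true) : Letter P.d)] ν) (-netDisp (cw b.tgt) ν)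
      have t3 := Int.natAbs_add_le (netDisp (cw b.src) ν) (netDisp [((b.dir, true) : Letter P.d)] ν)
      rw [Int.natAbs_neg] at t1 t2
      omega
    -- holonomy-flatness along the closed word, expanded piece by piece
    have hhol := hflat (τ b.src) _ (netDisp_eq_zero_of_walkEnd_eq hclosed hsmall)
    have p1 : holAt U (walk b.src [(b.dir, true)]) = U b := holAt_walk_single_true U b.src b.dir
    have p2 : holAt U (walk b.tgt (wordRev (cw b.tgt))) = (holAt U (walk (τ b.tgt) (cw b.tgt)))⁻¹ := by
      have h := holAt_walk_wordRev U (τ b.tgt) (cw b.tgt); rwa [hcw_end] at h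
    have p3 : holAt U (walk (τ b.tgt) (wordRev ω)) = 1 := by
      have h := holAt_walk_wordRev U (τ b.src) ω
      rw [hωend, hωhol, inv_one] at h
      exact h
    rw [holAt_walk_append U (τ b.src) (cw b.src ++ [(b.dir, true)] ++ wordRev (cw b.tgt)) (wordRev ω), end3, p3, mul_one,
      holAt_walk_append U (τ b.src) (cw b.src ++ [(b.dir, true)]) (wordRev (cw b.tgt)), end2, p2,
      holAt_walk_append U (τ b.src) (cw b.src) [(b.dir, true)], hcw_end, p1] at hhol
    exact hhol
  -- the comb gauge
  refine ⟨fun x => (holAt U (walk (τ x) (cw x)))⁻¹, ?_, ?_⟩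
  swap
  · -- `1^{u} = U`
    funext b
    show (holAt U (walk (τ b.src) (cw b.src)))⁻¹ * 1 * ((holAt U (walk (τ b.tgt) (cw b.tgt)))⁻¹)⁻¹ = U b
    rw [mul_one, inv_inv]
    exact (eq_inv_mul_of_mul_eq (mul_inv_eq_one.mp (hbond b))).symm
  · -- `u = 1` at every tower site
    -- (i) at the `Γ`-ends: the level of `ι_j s` is `j`, the comb is empty
    have hfix : ∀ {j : ℕ}, j ≤ k → ∀ {s : Site P j}, s ∈ Bj M₁ Z k j → (holAt U (walk (τ (embIter j s)) (cw (embIter j s))))⁻¹ = 1 := by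
      intro j hj s hs
      have hb : blockIter j (embIter j s) = s := blockIter_embIter (hj.trans hk) s
      have hsj : blockIter j (embIter j s) ∈ Bj M₁ Z k j := by rw [hb]; exact hs
      have e : lv (embIter j s) = j := level_unique hM1 hk hdiv (hlv _).1 hj (hlv _).2 hsj
      have hτs : τ (embIter j s) = embIter j s := by
        rw [hτ]
        revert e
        generalize lv (embIter j s) = n
        intro e
        subst e
        rw [hb]
      rw [hcw, hτs, ← hb]
      rw [holAt_comb_eq_one_of_eq U _ _ (by rw [hb]), inv_one]
    -- (ii) at BOTH ends: along the trivial straight segment `u` agrees at `ι_j c₋` and `ι_j c₊` ((8) telescoped for the pure gauge `U = 1^{u}`)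
    have hU : GaugeField.gaugeAct (fun x => (holAt U (walk (τ x) (cw x)))⁻¹) 1 = U := by
      funext b
      show (holAt U (walk (τ b.src) (cw b.src)))⁻¹ * 1 * ((holAt U (walk (τ b.tgt) (cw b.tgt)))⁻¹)⁻¹ = U b
      rw [mul_one, inv_inv]
      exact (eq_inv_mul_of_mul_eq (mul_inv_eq_one.mp (hbond b))).symm
    intro j hj c hc
    have hends : (holAt U (walk (τ (embIter j c.src)) (cw (embIter j c.src))))⁻¹ = (holAt U (walk (τ (embIter j c.tgt)) (cw (embIter j c.tgt))))⁻¹ := by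
      have h := hseg j hj c hc
      rw [← hU, holAt_gaugeAct_one_walk, ← embIter_shift_eq_walkEnd] at h
      exact (mul_inv_eq_one.mp h)
    show (holAt U (walk (τ (embIter j c.src)) (cw (embIter j c.src))))⁻¹ = 1 ∧ (holAt U (walk (τ (embIter j c.tgt)) (cw (embIter j c.tgt))))⁻¹ = 1
    rcases (show c.src ∈ Bj M₁ Z k j ∨ c.tgt ∈ Bj M₁ Z k j from hc) with hs | ht
    · exact ⟨hfix hj hs, by rw [← hends]; exact hfix hj hs⟩
    · exact ⟨by rw [hends]; exact hfix hj ht, hfix hj ht⟩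

/-- ★★★ **THE (T1@q₀)-CENTRAL CLAUSE BETWEEN TWO FLAT FIBRE CONFIGURATIONS.**  If `U` and `U₀` are both holonomy-flat with trivial straight transporters on the constrained bonds of
`𝐁_k(Z)` (hypotheses of `exists_gauge_eq_one_on_towers_of_flat_segments`), then `U^u = U₀` for a gauge transformation `u` whose tower restrictions `toMS u j` are EQUAL and CENTRAL (indeed
`= 1`) at the two tower sites of every constrained bond — the shape of the (T1@q₀) row of the (J0′) producer of record (`…N12MinimiserFamilyOfClassThreshold` :176).
[cite: Balaban1985Variational, Thm 1 p.279, (3)–(4) p.278; Balaban1988Convergent, (2.2) p.255, (2.10)–(2.12) p.256; Balaban1989LargeFieldII, (1.25) p.362] -/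
theorem exists_towerCentral_gauge_of_flat_segments (hM : 2 ≤ M₁) (hk1 : 1 ≤ k) (hk : k ≤ P.m + P.K) (hdiv : side P.L M₁ k ∣ P.sitesPerDir 0)
    (hfit : (P.d + 3) * P.L ^ k ≤ P.sitesPerDir 0) (U U₀ : GaugeField P 0 G)
    (hflat : ∀ (x : Site P 0) (w : List (Letter P.d)), (∀ ν, netDisp w ν = 0) → holAt U (walk x w) = 1)
    (hseg : ∀ j, j ≤ k → ∀ c ∈ bondsOf (Bj M₁ Z k j), holAt U (walk (embIter j c.src) (List.replicate (P.L ^ j) (c.dir, true))) = 1)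
    (hflat₀ : ∀ (x : Site P 0) (w : List (Letter P.d)), (∀ ν, netDisp w ν = 0) → holAt U₀ (walk x w) = 1)
    (hseg₀ : ∀ j, j ≤ k → ∀ c ∈ bondsOf (Bj M₁ Z k j), holAt U₀ (walk (embIter j c.src) (List.replicate (P.L ^ j) (c.dir, true))) = 1) :
    ∃ u : GaugeTransf P 0 G, (∀ j, j ≤ k → ∀ b ∈ bondsOf (Bj M₁ Z k j),
        toMS u j b.src = toMS u j b.tgt ∧ ∀ g : G, toMS u j b.src * g = g * toMS u j b.src) ∧ GaugeField.gaugeAct u U = U₀ := by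
  obtain ⟨u₁, hu₁, hU⟩ := exists_gauge_eq_one_on_towers_of_flat_segments hM hk1 hk hdiv hfit U hflat hseg
  obtain ⟨u₀, hu₀, hU₀⟩ := exists_gauge_eq_one_on_towers_of_flat_segments hM hk1 hk hdiv hfit U₀ hflat₀ hseg₀
  refine ⟨fun x => u₀ x * (u₁ x)⁻¹, fun j hj b hb => ?_, ?_⟩
  · obtain ⟨h1s, h1t⟩ := hu₁ j hj b hb
    obtain ⟨h0s, h0t⟩ := hu₀ j hj b hb
    show u₀ (embIter j b.src) * (u₁ (embIter j b.src))⁻¹ = u₀ (embIter j b.tgt) * (u₁ (embIter j b.tgt))⁻¹ ∧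
      ∀ g : G, u₀ (embIter j b.src) * (u₁ (embIter j b.src))⁻¹ * g = g * (u₀ (embIter j b.src) * (u₁ (embIter j b.src))⁻¹)
    rw [h1s, h1t, h0s, h0t]
    exact ⟨rfl, fun g => by simp⟩
  · rw [← hU, gaugeAct_gaugeAct, ← hU₀]
    congr 1
    funext x
    show u₀ x * (u₁ x)⁻¹ * u₁ x = u₀ x
    rw [inv_mul_cancel_right]

/-- ★★ **THE SAME WITH `U₀ = 1`** (the flat configuration itself: holonomy-flat and with trivial segments for free): every holonomy-flat `U` with trivial straight transporters on the
constrained bonds of `𝐁_k(Z)` is carried to `1` by a tower-central (indeed tower-trivial) gauge transformation. [cite: Balaban1985Variational, Thm 1 p.279, (3)–(4) p.278; Balaban1988Convergent, (2.10)–(2.12) p.256] -/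
theorem exists_towerCentral_gauge_to_one_of_flat_segments (hM : 2 ≤ M₁) (hk1 : 1 ≤ k) (hk : k ≤ P.m + P.K) (hdiv : side P.L M₁ k ∣ P.sitesPerDir 0)
    (hfit : (P.d + 3) * P.L ^ k ≤ P.sitesPerDir 0) (U : GaugeField P 0 G)
    (hflat : ∀ (x : Site P 0) (w : List (Letter P.d)), (∀ ν, netDisp w ν = 0) → holAt U (walk x w) = 1)
    (hseg : ∀ j, j ≤ k → ∀ c ∈ bondsOf (Bj M₁ Z k j), holAt U (walk (embIter j c.src) (List.replicate (P.L ^ j) (c.dir, true))) = 1) :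
    ∃ u : GaugeTransf P 0 G, (∀ j, j ≤ k → ∀ b ∈ bondsOf (Bj M₁ Z k j),
        toMS u j b.src = toMS u j b.tgt ∧ ∀ g : G, toMS u j b.src * g = g * toMS u j b.src) ∧ GaugeField.gaugeAct u U = 1 :=
  exists_towerCentral_gauge_of_flat_segments hM hk1 hk hdiv hfit U 1 hflat hseg (fun _ _ _ => holAt_one_eq_one _)
    (fun _ _ _ _ => holAt_one_eq_one _)

end Summit.QuantumFields.YangMills.BalabanUVNodes.N12FlatDatumRigidity
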